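import Mathlib
import Summits.Ventures.PercRepro2.Defs
import Summits.Ventures.PercRepro2.Independence
import Summits.Ventures.PercRepro2.Harris
import Summits.Ventures.PercRepro2.Graph
import Summits.Ventures.PercRepro2.Exploration
import Summits.Ventures.PercRepro2.Events
import Summits.Ventures.PercRepro2.Induced
import Summits.Ventures.PercRepro2.BHK
import Summits.Ventures.PercRepro2.BHKEvents
import Summits.Ventures.PercRepro2.OneEdge
import Summits.Ventures.PercRepro2.RBRoot
import Summits.Ventures.PercRepro2.RBRootEdge
import Summits.Ventures.PercRepro2.RBRootEdgePin
import Summits.Ventures.PercRepro2.RBRootEdgeMain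
import Summits.Ventures.PercRepro2.RBRootEdgeT
import Summits.Ventures.PercRepro2.RBDefs
import Summits.Ventures.PercRepro2.RBClubDefs
import Summits.Ventures.PercRepro2.RBClubRoot

/-!
# The CROSS coarse form 2′RB-CLUB-K: definition and the root-edge peeling (blind cell PercRepro2,
mine-a g8; MINE-A.md §49 addendum, proofs/MINEA-CLUB.md §7 addendum)

`ClubH p ends o b s t w` is the cross mirror of `Club` (cleared by `P(Q)`): with `M = {s ↔ w}`,
`bL = {b ↔ s}`, `oH = {o ↔ t}`,
`P(Q ∩ M ∩ bL ∩ oH) + P(Q ∩ Mᶜ ∩ bL) P(Q ∩ Mᶜ ∩ oH) / P(Q ∩ Mᶜ) ≤ P(Q ∩ bL) P(Q ∩ oH) / P(Q)`,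
i.e. `μ(w ∈ C_s, b ∈ C_s, o ∈ C_t) + μ(w ∉ C_s) μ(b ∈ C_s | w ∉ C_s) μ(o ∈ C_t | w ∉ C_s) ≤ μ(b ∈ C_s) μ(o ∈ C_t)`
under `μ = P(· | s ↮ t)`. MINE-A.md §43: `Row(cross) = (♣H) + (1 − p)·Cov_{μ′}^{C(w)}(bL̂, oĤ)` with the
second term `≤ 0` by the TN theorem; (♣H) `≤ 0` at every kernel third vertex (paper + an exact LP
certificate over the proved BHK family, MINE-A.md §49 addendum).

This file: the ROOT EDGES at the third vertex can be removed from the cross form, at EVERY third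
vertex — `clubH_of_update_root` (`e = {w, s}`: `M` sure on the open branch, BHK 1.4 on the merged
graph, the shifts `μ₁(bL) ≥ μ₀(bL)`, `μ₁(oH) ≤ μ₀(oH)` and `RBRootEdge.mix_cross`),
`clubH_of_update_root_t` (`e = {w, t}`: `M` null on the open branch, `P₁(Q ∩ bL) = P₀(Q ∩ Mᶜ ∩ bL)`
and `P₁(Q) = P₀(Q ∩ Mᶜ)` so the refinement term vanishes, the shifts `μ₁(bL) ≤ μ₀(bL)`,
`μ₁(oH) ≥ μ₀(oH)`), `ClubH_of_no_root_edges` (every root edge at `w` zeroed).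
-/

namespace Summit.Ventures.PercRepro2

namespace RB

open scoped Classical

variable {V : Type*} {E : Type*} [Fintype E] [DecidableEq E] [Fintype V] [DecidableEq V]
  {R : Type*} [Field R] [LinearOrder R] [IsStrictOrderedRing R]

/-- **The cross coarse form (♣H)** (MINE-A.md §43, §49 addendum), cleared by `P(Q)`: with
`M = {s ↔ w}`, `bL = {b ↔ s}`, `oH = {o ↔ t}`,
`P(Q ∩ M ∩ bL ∩ oH) + P(Q ∩ Mᶜ ∩ bL) P(Q ∩ Mᶜ ∩ oH) / P(Q ∩ Mᶜ) ≤ P(Q ∩ bL) P(Q ∩ oH) / P(Q)`.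
Holds at every kernel third vertex (`N(w) ⊆ {s,t,b,o}`; paper + certificate); false in general
(MINE-A.md §47: the cross witness on `c7_00536`). -/
def ClubH (p : E → R) (ends : E → Sym2 V) (o b s t w : V) : Prop :=
  prob p (Qst ends s t ∩ connEvent ends s w ∩ connEvent ends b s ∩ connEvent ends o t) +
      prob p (Qst ends s t ∩ (connEvent ends s w)ᶜ ∩ connEvent ends b s) *
          prob p (Qst ends s t ∩ (connEvent ends s w)ᶜ ∩ connEvent ends o t) /
        prob p (Qst ends s t ∩ (connEvent ends s w)ᶜ) ≤
    prob p (Qst ends s t ∩ connEvent ends b s) * prob p (Qst ends s t ∩ connEvent ends o t) /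
      prob p (Qst ends s t)

end RB

namespace RBClubCross

open scoped Classical

section Forced

variable {V : Type*} {E : Type*} [Fintype E] [DecidableEq E] [Fintype V] {R : Type*} [Field R]
  [LinearOrder R] [IsStrictOrderedRing R] (ends : E → Sym2 V) (s t w : V) {p : E → R} {e : E}

/-- **BHK 1.4 under `p[e ↦ 1]`**, cleared: `P₁(Q ∩ bL ∩ oH) P₁(Q) ≤ P₁(Q ∩ bL) P₁(Q ∩ oH)`. -/
lemma bhk_cross_update_one (hp : IsProbVec p) (b o : V) :
    prob (Function.update p e 1) ((connEvent ends s t)ᶜ ∩ connEvent ends b s ∩ connEvent ends o t) *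
        prob (Function.update p e 1) (connEvent ends s t)ᶜ ≤
      prob (Function.update p e 1) ((connEvent ends s t)ᶜ ∩ connEvent ends b s) *
        prob (Function.update p e 1) ((connEvent ends s t)ᶜ ∩ connEvent ends o t) := by
  have hp1 : IsProbVec (Function.update p e 1) := hp.update e zero_le_one le_rfl
  have key := bhk_cross_cluster (Function.update p e 1) hp1 ends s t
    (RBRoot.isUpperSet_mem b) (RBRoot.isUpperSet_mem o)
  rw [← RBRoot.connEvent_eq_clusterInEvent_right ends b s,
    ← RBRoot.connEvent_eq_clusterInEvent_right ends o t] at key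
  have e1 : connEvent ends b s ∩ (connEvent ends s t)ᶜ =
      (connEvent ends s t)ᶜ ∩ connEvent ends b s := Set.inter_comm _ _
  have e2 : connEvent ends o t ∩ (connEvent ends s t)ᶜ =
      (connEvent ends s t)ᶜ ∩ connEvent ends o t := Set.inter_comm _ _
  have e3 : connEvent ends b s ∩ connEvent ends o t ∩ (connEvent ends s t)ᶜ =
      (connEvent ends s t)ᶜ ∩ connEvent ends b s ∩ connEvent ends o t := by
    ext ω; simp only [Set.mem_inter_iff]; tauto
  rw [e1, e2, e3] at key
  exact key

/-- **Monotonicity of the other side, edge at `t`**: `μ₁(o ↔ t) ≥ μ₀(o ↔ t)` for `e = {w, t}`, cleared: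
`P₀(Q ∩ oH) P₁(Q) ≤ P₁(Q ∩ oH) P₀(Q)` — `RBRootEdge.mono_root` with the roots exchanged. -/
lemma mono_other_t (hp : IsProbVec p) (hends : ends e = s(w, t)) (o : V) :
    prob (Function.update p e 0) ((connEvent ends s t)ᶜ ∩ connEvent ends o t) *
        prob (Function.update p e 1) (connEvent ends s t)ᶜ ≤
      prob (Function.update p e 1) ((connEvent ends s t)ᶜ ∩ connEvent ends o t) *
        prob (Function.update p e 0) (connEvent ends s t)ᶜ := by
  have key := RBRootEdge.mono_root ends t s w hp hends o
  rw [RBRoot.compl_connEvent_comm ends t s] at key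
  exact key

end Forced

section Mixture

variable {R : Type*} [Field R] [LinearOrder R] [IsStrictOrderedRing R]

/-- A forced mass is bounded by its ratio: `j ≤ a c / z` from `j z ≤ a c`, `0 ≤ j ≤ z`. -/
lemma le_div_of_bhk {a c z j : R} (hj : 0 ≤ j) (hjz : j ≤ z) (h : j * z ≤ a * c) :
    j ≤ a * c / z := by
  rcases eq_or_lt_of_le (hj.trans hjz) with hz | hz
  · have hj' : j = 0 := le_antisymm (hz ▸ hjz) hj
    rw [← hz, hj', div_zero]
  · rw [le_div_iff₀ hz]
    exact h

/-- **The cross two-point step at a root edge `{w, s}`**: with `0 ≤ aᵢ ≤ zᵢ`, `0 ≤ cᵢ ≤ zᵢ`, the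
shifts of opposite signs, BHK 1.4 `j₁ z₁ ≤ a₁ c₁` on the forced branch and the cross coarse row on
the closed branch, the mixed left-hand side is at most the ratio of mixtures. -/
lemma clubH_mix_root {q a0 a1 c0 c1 z0 z1 j1 m0 x0 y0 n0 : R} (hq0 : 0 ≤ q) (hq1 : q ≤ 1)
    (ha0 : 0 ≤ a0) (ha0z : a0 ≤ z0) (ha1 : 0 ≤ a1) (ha1z : a1 ≤ z1) (hc0 : 0 ≤ c0) (hc0z : c0 ≤ z0)
    (hc1 : 0 ≤ c1) (hc1z : c1 ≤ z1) (hAC : (a1 * z0 - a0 * z1) * (c1 * z0 - c0 * z1) ≤ 0)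
    (hj1 : 0 ≤ j1) (hj1z : j1 ≤ z1) (hbhk : j1 * z1 ≤ a1 * c1)
    (h0 : m0 + x0 * y0 / n0 ≤ a0 * c0 / z0) :
    (q * j1 + (1 - q) * m0) + ((1 - q) * x0) * ((1 - q) * y0) / ((1 - q) * n0) ≤
      (q * a1 + (1 - q) * a0) * (q * c1 + (1 - q) * c0) / (q * z1 + (1 - q) * z0) := by
  have hmix := RBRootEdge.mix_cross hq0 hq1 ha0 ha0z ha1 ha1z hc0 hc0z hc1 hc1z hAC
  have h1 : j1 ≤ a1 * c1 / z1 := le_div_of_bhk hj1 hj1z hbhk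
  rw [RBClubRoot.scaled_ratio]
  have hq1' : 0 ≤ 1 - q := sub_nonneg.2 hq1
  calc (q * j1 + (1 - q) * m0) + (1 - q) * (x0 * y0 / n0)
      = q * j1 + (1 - q) * (m0 + x0 * y0 / n0) := by ring
    _ ≤ q * (a1 * c1 / z1) + (1 - q) * (a0 * c0 / z0) :=
        add_le_add (mul_le_mul_of_nonneg_left h1 hq0) (mul_le_mul_of_nonneg_left h0 hq1')
    _ ≤ (q * a1 + (1 - q) * a0) * (q * c1 + (1 - q) * c0) / (q * z1 + (1 - q) * z0) := hmix

/-- **The cross two-point step at a root edge `{w, t}`**: the forced masses `a₁ = P₁(Q ∩ bL)`,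
`z₁ = P₁(Q)` are the avoided masses `x₀ = P₀(Q ∩ Mᶜ ∩ bL)`, `n₀ = P₀(Q ∩ Mᶜ)` of the closed branch,
so the refinement term vanishes. -/
lemma clubH_mix_root_t {q a0 a1 c0 c1 z0 z1 m0 x0 y0 n0 : R} (hq0 : 0 ≤ q) (hq1 : q ≤ 1)
    (ha0 : 0 ≤ a0) (ha0z : a0 ≤ z0) (ha1 : 0 ≤ a1) (ha1z : a1 ≤ z1) (hc0 : 0 ≤ c0) (hc0z : c0 ≤ z0)
    (hc1 : 0 ≤ c1) (hc1z : c1 ≤ z1) (hAC : (a1 * z0 - a0 * z1) * (c1 * z0 - c0 * z1) ≤ 0)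
    (hx : x0 = a1) (hn : n0 = z1) (h0 : m0 + x0 * y0 / n0 ≤ a0 * c0 / z0) :
    (q * 0 + (1 - q) * m0) +
        (q * a1 + (1 - q) * x0) * (q * c1 + (1 - q) * y0) / (q * z1 + (1 - q) * n0) ≤
      (q * a1 + (1 - q) * a0) * (q * c1 + (1 - q) * c0) / (q * z1 + (1 - q) * z0) := by
  rw [hx, hn] at h0 ⊢
  have hmix := RBRootEdge.mix_cross hq0 hq1 ha0 ha0z ha1 ha1z hc0 hc0z hc1 hc1z hAC
  have hq1' : 0 ≤ 1 - q := sub_nonneg.2 hq1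
  have e1 : q * a1 + (1 - q) * a1 = a1 := by ring
  have e3 : q * z1 + (1 - q) * z1 = z1 := by ring
  rw [e1, e3]
  have e4 : a1 * (q * c1 + (1 - q) * y0) / z1 = q * (a1 * c1 / z1) + (1 - q) * (a1 * y0 / z1) := by
    rw [mul_add, add_div, mul_div_assoc, mul_div_assoc]
    ring
  calc (q * 0 + (1 - q) * m0) + a1 * (q * c1 + (1 - q) * y0) / z1
      = q * (a1 * c1 / z1) + (1 - q) * (m0 + a1 * y0 / z1) := by rw [e4]; ring
    _ ≤ q * (a1 * c1 / z1) + (1 - q) * (a0 * c0 / z0) :=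
        add_le_add le_rfl (mul_le_mul_of_nonneg_left h0 hq1')
    _ ≤ (q * a1 + (1 - q) * a0) * (q * c1 + (1 - q) * c0) / (q * z1 + (1 - q) * z0) := hmix

end Mixture

section Main

variable {V : Type*} {E : Type*} [Fintype E] [DecidableEq E] [Fintype V] [DecidableEq V]
  {R : Type*} [Field R] [LinearOrder R] [IsStrictOrderedRing R] (ends : E → Sym2 V) {p : E → R}
  {e : E}

omit [DecidableEq V] in
/-- **The edge to the root `s` can be removed from the cross coarse form.** For `e = {w, s}`,
`ClubH p` follows from `ClubH p[e ↦ 0]`. -/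
theorem clubH_of_update_root (hp : IsProbVec p) {s t w o b : V} (hends : ends e = s(w, s))
    (h0 : RB.ClubH (Function.update p e 0) ends o b s t w) : RB.ClubH p ends o b s t w := by
  have hp0 : IsProbVec (Function.update p e 0) := hp.update e le_rfl zero_le_one
  have hp1 : IsProbVec (Function.update p e 1) := hp.update e zero_le_one le_rfl
  unfold RB.ClubH RB.Qst at h0 ⊢
  rw [prob_eq_pin p ((connEvent ends s t)ᶜ ∩ connEvent ends b s) e,
    prob_eq_pin p ((connEvent ends s t)ᶜ ∩ connEvent ends o t) e,
    prob_eq_pin p (connEvent ends s t)ᶜ e,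
    prob_eq_pin p ((connEvent ends s t)ᶜ ∩ connEvent ends s w ∩ connEvent ends b s ∩
      connEvent ends o t) e,
    prob_eq_pin p ((connEvent ends s t)ᶜ ∩ (connEvent ends s w)ᶜ ∩ connEvent ends b s) e,
    prob_eq_pin p ((connEvent ends s t)ᶜ ∩ (connEvent ends s w)ᶜ ∩ connEvent ends o t) e,
    prob_eq_pin p ((connEvent ends s t)ᶜ ∩ (connEvent ends s w)ᶜ) e,
    RBClubRoot.prob_update_one_inter_conn p ends s w hends,
    RBClubRoot.prob_update_one_inter_compl_conn_inter p ends s w hends,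
    RBClubRoot.prob_update_one_inter_compl_conn_inter p ends s w hends,
    RBClubRoot.prob_update_one_inter_compl_conn p ends s w hends]
  simp only [mul_zero, zero_add]
  exact clubH_mix_root (hp.nonneg e) (hp.le_one e) (prob_nonneg hp0 _)
    (prob_mono hp0 Set.inter_subset_left) (prob_nonneg hp1 _) (prob_mono hp1 Set.inter_subset_left)
    (prob_nonneg hp0 _) (prob_mono hp0 Set.inter_subset_left) (prob_nonneg hp1 _)
    (prob_mono hp1 Set.inter_subset_left)
    (mul_nonpos_of_nonneg_of_nonpos (sub_nonneg.2 (RBRootEdge.mono_root ends s t w hp hends b))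
      (sub_nonpos.2 (RBRootEdge.mono_other ends s t w hp hends o)))
    (prob_nonneg hp1 _) (prob_mono hp1 (Set.inter_subset_left.trans Set.inter_subset_left))
    (bhk_cross_update_one ends s t hp b o) h0

omit [DecidableEq V] in
/-- **The edge to the other root `t` can be removed from the cross coarse form.** For `e = {w, t}`,
`ClubH p` follows from `ClubH p[e ↦ 0]`. -/
theorem clubH_of_update_root_t (hp : IsProbVec p) {s t w o b : V} (hends : ends e = s(w, t))
    (h0 : RB.ClubH (Function.update p e 0) ends o b s t w) : RB.ClubH p ends o b s t w := by
  have hp0 : IsProbVec (Function.update p e 0) := hp.update e le_rfl zero_le_one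
  have hp1 : IsProbVec (Function.update p e 1) := hp.update e zero_le_one le_rfl
  have hx : prob (Function.update p e 1) ((connEvent ends s t)ᶜ ∩ connEvent ends b s) =
      prob (Function.update p e 0) ((connEvent ends s t)ᶜ ∩ (connEvent ends s w)ᶜ ∩
        connEvent ends b s) := by
    rw [RBRootEdge.prob_update_one_conn_root_t p ends s t w hends b,
      RBClubRoot.connEvent_comm ends w s, Set.inter_right_comm]
  have hn : prob (Function.update p e 1) (connEvent ends s t)ᶜ =
      prob (Function.update p e 0) ((connEvent ends s t)ᶜ ∩ (connEvent ends s w)ᶜ) := by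
    rw [RBRootEdge.prob_update_one_compl_t p ends s t w hends, RBClubRoot.connEvent_comm ends w s]
  have hAC := mul_nonpos_of_nonpos_of_nonneg
    (sub_nonpos.2 (RBRootEdge.mono_root_t ends s t w hp hends b))
    (sub_nonneg.2 (mono_other_t ends s t w hp hends o))
  unfold RB.ClubH RB.Qst at h0 ⊢
  rw [prob_eq_pin p ((connEvent ends s t)ᶜ ∩ connEvent ends b s) e,
    prob_eq_pin p ((connEvent ends s t)ᶜ ∩ connEvent ends o t) e,
    prob_eq_pin p (connEvent ends s t)ᶜ e,
    prob_eq_pin p ((connEvent ends s t)ᶜ ∩ connEvent ends s w ∩ connEvent ends b s ∩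
      connEvent ends o t) e,
    prob_eq_pin p ((connEvent ends s t)ᶜ ∩ (connEvent ends s w)ᶜ ∩ connEvent ends b s) e,
    prob_eq_pin p ((connEvent ends s t)ᶜ ∩ (connEvent ends s w)ᶜ ∩ connEvent ends o t) e,
    prob_eq_pin p ((connEvent ends s t)ᶜ ∩ (connEvent ends s w)ᶜ) e,
    RBClubRoot.prob_update_one_compl_inter_conn_t p ends s t w hends,
    RBClubRoot.prob_update_one_compl_inter_compl_conn_t p ends s t w hends,
    RBClubRoot.prob_update_one_compl_inter_compl_conn_t p ends s t w hends,
    RBClubRoot.prob_update_one_compl_inter_compl_conn_t' p ends s t w hends]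
  exact clubH_mix_root_t (hp.nonneg e) (hp.le_one e) (prob_nonneg hp0 _)
    (prob_mono hp0 Set.inter_subset_left) (prob_nonneg hp1 _) (prob_mono hp1 Set.inter_subset_left)
    (prob_nonneg hp0 _) (prob_mono hp0 Set.inter_subset_left) (prob_nonneg hp1 _)
    (prob_mono hp1 Set.inter_subset_left) hAC hx.symm hn.symm h0

omit [DecidableEq V] in
/-- **One root edge at `w` can be removed from the cross coarse form (typed).** -/
theorem ClubH_of_update_root_edge (hp : IsProbVec p) (o b s t w : V) {g : E}
    (hg : ends g = s(w, s) ∨ ends g = s(w, t))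
    (h : RB.ClubH (Function.update p g 0) ends o b s t w) : RB.ClubH p ends o b s t w := by
  rcases hg with hgs | hgt
  · exact clubH_of_update_root ends hp hgs h
  · exact clubH_of_update_root_t ends hp hgt h

omit [DecidableEq V] in
/-- **A finite set of root edges at `w` can be removed from the cross coarse form (typed).** -/
theorem ClubH_of_zero_roots (hp : IsProbVec p) (o b s t w : V) (F : Finset E)
    (hF : ∀ e ∈ F, ends e = s(w, s) ∨ ends e = s(w, t))
    (h : RB.ClubH (fun e => if e ∈ F then 0 else p e) ends o b s t w) :
    RB.ClubH p ends o b s t w := by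
  induction F using Finset.induction_on with
  | empty =>
    simpa using h
  | insert a F ha ih =>
    refine ih (fun e he => hF e (Finset.mem_insert_of_mem he)) ?_
    have hpF : IsProbVec (fun e => if e ∈ F then 0 else p e) :=
      ⟨fun e => by split_ifs; exacts [le_rfl, hp.nonneg e],
       fun e => by split_ifs; exacts [zero_le_one, hp.le_one e]⟩
    have heq : (fun e => if e ∈ insert a F then 0 else p e) =
        Function.update (fun e => if e ∈ F then 0 else p e) a 0 := by
      funext e
      by_cases h' : e = a
      · subst h'; simp
      · rw [Function.update_of_ne h']; simp [h']
    rw [heq] at h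
    exact ClubH_of_update_root_edge ends hpF o b s t w (hF a (Finset.mem_insert_self a F)) h

/-- **Every root edge at `w` can be removed from the cross coarse form (typed)**: `ClubH p` follows
from `ClubH` at the weight vector in which every edge between `w` and `{s, t}` has weight `0`. -/
theorem ClubH_of_no_root_edges (hp : IsProbVec p) (o b s t w : V)
    (h : RB.ClubH (fun e => if ends e = s(w, s) ∨ ends e = s(w, t) then 0 else p e)
      ends o b s t w) : RB.ClubH p ends o b s t w := by
  set F : Finset E := Finset.univ.filter (fun e => ends e = s(w, s) ∨ ends e = s(w, t)) with hF
  have hFmem : ∀ e ∈ F, ends e = s(w, s) ∨ ends e = s(w, t) :=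
    fun e he => (Finset.mem_filter.1 he).2
  have heq : (fun e => if ends e = s(w, s) ∨ ends e = s(w, t) then 0 else p e) =
      (fun e => if e ∈ F then 0 else p e) := by
    funext e
    simp only [hF, Finset.mem_filter, Finset.mem_univ, true_and]
  rw [heq] at h
  exact ClubH_of_zero_roots ends hp o b s t w F hFmem h

end Main

end RBClubCross

end Summit.Ventures.PercRepro2
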